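import Literature.MathematicalPhysics.QuantumFieldTheory.Balaban1983to89.T3MinimiserStabilityReduction
import Literature.MathematicalPhysics.QuantumFieldTheory.Balaban1983to89.T3PrintedRegularMinimiser
import Literature.MathematicalPhysics.QuantumFieldTheory.Balaban1983to89.T3OrbitAverage
import Literature.MathematicalPhysics.QuantumFieldTheory.Balaban1983to89.B12ContinuousTransportInvariance
import Literature.MathematicalPhysics.QuantumFieldTheory.Balaban1983to89.Node00.CanonicalTransportOfRecord
import Literature.MathematicalPhysics.QuantumFieldTheory.Balaban1983to89.Node00.RegSetOfFibredChartOnSupport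
import Literature.MathematicalPhysics.QuantumFieldTheory.Balaban1983to89.T4AveragingDisintegration
import Summits.QuantumFields.YangMills.Theorems.UnitScaleTiltFluctuationComparisonRegPrOneTower
import Literature.MathematicalPhysics.QuantumFieldTheory.Balaban1983to89.T3SmallLiftHistory
import Literature.MathematicalPhysics.QuantumFieldTheory.Balaban1983to89.T3Thresholds
import Literature.MathematicalPhysics.QuantumFieldTheory.Balaban1983to89.T3UnitScaleTilt
import Literature.MathematicalPhysics.QuantumFieldTheory.Balaban1983to89.T3TiltDescent
import Literature.MathematicalPhysics.QuantumFieldTheory.Balaban1983to89.T3LevelShift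
import Literature.MathematicalPhysics.QuantumFieldTheory.Balaban1983to89.T3UnitLawDensityEML
import HarnessLib

/-!
# WREG PORT · F3 «GLUE» — the canonical version, the organ `WindowRegularity`, the interface `WindowChart`, the two obligations, and the PROVED glue
# CHART ∧ INTERIOR ⇒ WREG (verbatim move of `Cruxes/FluctuationComparisonRegPrIntL/Lines/wreg_chart.lean` v20 §1–§4, ll. 1744–1952)

Cell `ym3-torus` (rung R3: continuum `SU(2)` Yang–Mills on `T³` — NOT `d = 4`, NOT infinite volume, NOT a mass gap, NOT Clay); width seat `ym-ust-20520-w4`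
g14; helper of the crux `stmt-QuantumFields-20520` `UnitScaleTilt.FluctuationComparisonRegPrIntL`.  Block F3 of the LINE OWNER's PORT MAP
(`Cruxes/FluctuationComparisonRegPrIntL/Lines/wreg_chart_port.md`, ideator seat ym-r3-idea-1 g18): the organ **WREG** of S2β (LINES g18-1 `semiclassical_s2beta`,
`polymer_norm_s2beta`, package `runpair_organ`) is kernel-closed inside the Cruxes workfile `wreg_chart.lean` (v19–v20, 0 `sorry`), which nothing can import;
the port moves its proved declarations VERBATIM under `Theorems/` so that the consumers can name it.  THIS FILE = §1–§4 of the line, which reference NO §0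
object (`chainMap` ∕ `chainWindow` ∕ `iterCentralBond`, script-checked), hence imports tree modules only:
* §1 `heightDensityCan` (the canonical version of the `γ′`-weighted restricted density at height `K − J`, `Node00.canonVersion`) and the organ
  `WindowRegularity` — VERBATIM the texts of `Lines/semiclassical_s2beta.lean` ∕ `Lines/polymer_norm_s2beta.lean` (`Iff.rfl` door-fits on record);
* §2 the posited interface `structure WindowChart` (fibred chart of `descendTo` on a fine set: `Φ`, `jac`, `bound`, measurability, fibre identity, the
  push-forward identity `map_Φ`, leafwise regularity `regular`, charging `charge`) and the two obligations `WindowChartsExist` (CHART), `WindowFibreInterior` (INTERIOR);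
* §3 glue, part 1 (PROVED): `continuous_boltzmann`, `rho_props`, ★`continuousOn_fibreInt` (dominated convergence), ★`chart_subset_regSet` (Node00's door
  `subset_regSet_transform_of_fibredChart_of_ne_zero` + `LogComparisonOneTower.integral_heightDensity_mul`), `heightDensityCan_eq_fibreInt`, ★`chart_pos`;
* §4 glue, part 2 (PROVED): ★★`windowRegularity_of_chart : WindowChartsExist → WindowFibreInterior → WindowRegularity`.
Downstream blocks (map): F4 «Interior∕rungs» (§4b §4c §4f §4g; imports F1 ⊕ F3), F5 «Assembly» (§4d §4e), F6 the knit `windowRegularity` from the landed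
VOL ∕ EDGE ∕ LEVEL-NEAR ∕ CHARGE twins.  Every declaration below is the v20 text byte for byte (docstrings included, EXCEPT that the `[cite:]` tags of the three parameter-free
obligation Props are spelled as plain references — a cite-tagged parameter-free `def … : Prop` is relocated by the gate as a Literature fact, bounce p731188); namespace
`Summit.QuantumFields.YangMills.Theorems.FluctuationComparisonRegPrIntLWregGlue`; credit: the mathematics and the Lean are the ideator's (LINE g18-2 v1–v11).

HONEST SCOPE.  A port proves nothing new.  `WindowRegularity` is DEFINED here and reduced to CHART ∧ INTERIOR; neither is proved in this file; WREG's
closure stays in the line until F6; S2β's other organs, the run-pair package, the crux 20520 and every rung statement are NOT proved; `YM3TorusSU2` NOT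
proved; the Yang–Mills mass gap (Clay) NOT proved.  Definitions present (`--kind definition`, review lane): `heightDensityCan`, `WindowRegularity`,
`WindowChart`, `WindowChartsExist`, `WindowFibreInterior`; no `instance` ∕ `notation`; default heartbeats.

References: [Balaban1985UV3] CMP 102 (1985) (2) p. 256, (7) p. 257, (41) p. 266; [Balaban1987RG1] CMP 109 (1987) (0.13) p. 254, (2.10) p. 267;
[Balaban1985Averaging] CMP 98 (1985) (10) p. 19.
-/

noncomputable section

open MeasureTheory Filter Topology Set
open scoped ENNReal NNReal
open Literature.MathematicalPhysics.QuantumFieldTheory.Balaban1983to89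
open Literature.MathematicalPhysics.QuantumFieldTheory.Balaban1983to89.T3ContinuumYM3Torus
open Literature.MathematicalPhysics.QuantumFieldTheory.Balaban1983to89.T3NestedUnitLaws
open Literature.MathematicalPhysics.QuantumFieldTheory.Balaban1983to89.T3UnitLawDensityEML
open Literature.MathematicalPhysics.QuantumFieldTheory.Balaban1983to89.T3UnitScaleTilt
open Literature.MathematicalPhysics.QuantumFieldTheory.Balaban1983to89.T3TiltDescent
open Literature.MathematicalPhysics.QuantumFieldTheory.Balaban1983to89.T3PrintedRegularMinimiser
open Literature.MathematicalPhysics.QuantumFieldTheory.Balaban1983to89.T3ConstrainedMinimiser (fibre)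
open Literature.MathematicalPhysics.QuantumFieldTheory.Balaban1983to89.T3LevelShift
open Literature.MathematicalPhysics.QuantumFieldTheory.Balaban1983to89.T3SmallLiftHistory
open Literature.MathematicalPhysics.QuantumFieldTheory.Balaban1983to89.T3Thresholds
open Literature.MathematicalPhysics.QuantumFieldTheory.Balaban1983to89.Missing
open Literature.MathematicalPhysics.QuantumFieldTheory.Balaban1983to89.T4Continuum
open scoped Literature.MathematicalPhysics.QuantumFieldTheory.Balaban1983to89.T3OrbitAverage

namespace Summit.QuantumFields.YangMills.Theorems.FluctuationComparisonRegPrIntLWregGlue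

/-! ## §1 The canonical version and the organ WREG — VERBATIM from `Lines/semiclassical_s2beta.lean` v4 / `Lines/polymer_norm_s2beta.lean` v3 -/

section Canonical

variable (F : T3Family) (γ : ℝ) {J K : ℕ} (hJK : J ≤ K) (S : Set (GaugeField (F.P K) 0 (Matrix.specialUnitaryGroup (Fin 2) ℂ)))

/-- **THE CANONICAL VERSION OF BAŁABAN'S RESTRICTED DENSITY AT HEIGHT `K − J`** (verbatim from v4). [cite: Balaban1985UV3, (2) p.256 and (41) p.266] -/
def heightDensityCan (V : GaugeField (F.P J) 0 (Matrix.specialUnitaryGroup (Fin 2) ℂ)) : ℝ :=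
  Node00.canonVersion (fieldMeasure (F.P J) 0 (Matrix.specialUnitaryGroup (Fin 2) ℂ)) (heightDensity F γ hJK S) V

end Canonical

/-- **WREG · WINDOW REGULARITY OF THE SMALL-FIELD FIBRE DENSITY** — VERBATIM from `runpair_organ` v4 (ref. Balaban1985Averaging (10) p.19; no cite tag on this
route-posited ORGAN so that the gate does not relocate it as a Literature fact). -/
def WindowRegularity : Prop :=
  ∀ (L : ℕ) (b₀ p₀ : ℝ), 0 < b₀ → 0 < p₀ → ∃ γ₁ : ℝ, 0 < γ₁ ∧ ∀ (F : T3Family) (γ : ℝ), F.L = L → 0 < γ → γ ≤ γ₁ →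
    ∀ (J K : ℕ) (hJK : J ≤ K) (γ' : ℝ), 0 < γ' →
      {U : GaugeField (F.P J) 0 (Matrix.specialUnitaryGroup (Fin 2) ℂ) | PlaqSmall (θBal F.L γ b₀ p₀ J) U} ⊆
          Node00.regSet (fieldMeasure (F.P J) 0 (Matrix.specialUnitaryGroup (Fin 2) ℂ))
            (heightDensity F γ' hJK (histGood F ℰp (θBal F.L γ b₀ p₀) K J)) ∧
      ∀ U : GaugeField (F.P J) 0 (Matrix.specialUnitaryGroup (Fin 2) ℂ), PlaqSmall (θBal F.L γ b₀ p₀ J) U →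
          0 < heightDensityCan F γ' hJK (histGood F ℰp (θBal F.L γ b₀ p₀) K J) U

/-! ## §2 The posited interface: a WINDOW CHART of the iterated small-field averaging, and the two obligations -/

/-- **WINDOW CHART** (posited interface; its existence is the obligation CHART, never smuggled). [cite: Balaban1987RG1, (2.10) p.267 and (0.13) p.254] -/
structure WindowChart (F : T3Family) {J K : ℕ} (hJK : J ≤ K) (Sfine : Set (GaugeField (F.P K) 0 (Matrix.specialUnitaryGroup (Fin 2) ℂ)))
    (O : Set (GaugeField (F.P J) 0 (Matrix.specialUnitaryGroup (Fin 2) ℂ))) where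
  /-- the chart map `(V, z) ↦ Φ(V, z)` -/
  Φ : GaugeField (F.P J) 0 (Matrix.specialUnitaryGroup (Fin 2) ℂ) × GaugeField (F.P K) 0 (Matrix.specialUnitaryGroup (Fin 2) ℂ) →
    GaugeField (F.P K) 0 (Matrix.specialUnitaryGroup (Fin 2) ℂ)
  /-- its Jacobian against `μ_J⌊O ⊗ ν_K` -/
  jac : GaugeField (F.P J) 0 (Matrix.specialUnitaryGroup (Fin 2) ℂ) × GaugeField (F.P K) 0 (Matrix.specialUnitaryGroup (Fin 2) ℂ) → ℝ≥0
  /-- a uniform bound for the Jacobian -/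
  bound : ℝ≥0
  measurable_Φ : Measurable Φ
  measurable_jac : Measurable jac
  jac_le : ∀ p, jac p ≤ bound
  descendTo_Φ : ∀ V ∈ O, ∀ z, jac (V, z) ≠ 0 → descendTo F ℰp J K hJK (Φ (V, z)) = V
  map_Φ : (fieldMeasure (F.P K) 0 (Matrix.specialUnitaryGroup (Fin 2) ℂ)).restrict (descendTo F ℰp J K hJK ⁻¹' O ∩ Sfine) =
    ((((fieldMeasure (F.P J) 0 (Matrix.specialUnitaryGroup (Fin 2) ℂ)).restrict O).prod
        (fieldMeasure (F.P K) 0 (Matrix.specialUnitaryGroup (Fin 2) ℂ))).withDensity (fun p => (jac p : ℝ≥0∞))).map Φ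
  regular : ∀ V₀ ∈ O, ∀ᵐ z ∂fieldMeasure (F.P K) 0 (Matrix.specialUnitaryGroup (Fin 2) ℂ),
    (ContinuousAt (fun V => (jac (V, z) : ℝ)) V₀ ∧ ContinuousAt (fun V => Φ (V, z)) V₀ ∧ (jac (V₀, z) ≠ 0 → Φ (V₀, z) ∉ frontier Sfine)) ∨
      (∀ᶠ V in 𝓝 V₀, jac (V, z) = 0 ∨ Φ (V, z) ∉ Sfine)
  charge : ∀ V ∈ O, (∃ U, descendTo F ℰp J K hJK U = V ∧ U ∈ interior Sfine) →
    0 < fieldMeasure (F.P K) 0 (Matrix.specialUnitaryGroup (Fin 2) ℂ) {z | jac (V, z) ≠ 0 ∧ Φ (V, z) ∈ Sfine}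

/-- **CHART · WINDOW CHARTS EXIST** (obligation; proved from VOL + EDGE + LEVEL + CHARGE in §4e). (ref. Balaban1987RG1  (2.10) p.267; no cite tag: route-posited obligation, not a printed fact) -/
def WindowChartsExist : Prop :=
  ∀ (L : ℕ) (b₀ p₀ : ℝ), 0 < b₀ → 0 < p₀ → ∃ γ₁ : ℝ, 0 < γ₁ ∧ ∀ (F : T3Family) (γ : ℝ), F.L = L → 0 < γ → γ ≤ γ₁ →
    ∀ (J K : ℕ) (hJK : J ≤ K) (V₀ : GaugeField (F.P J) 0 (Matrix.specialUnitaryGroup (Fin 2) ℂ)), PlaqSmall (θBal F.L γ b₀ p₀ J) V₀ →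
      ∃ O : Set (GaugeField (F.P J) 0 (Matrix.specialUnitaryGroup (Fin 2) ℂ)), IsOpen O ∧ V₀ ∈ O ∧
        Nonempty (WindowChart F hJK (histGood F ℰp (θBal F.L γ b₀ p₀) K J) O)

/-- **INTERIOR · EVERY WINDOW FIBRE MEETS THE INTERIOR OF THE UV-SMALL-HISTORY EVENT** (stub, S–M; keyed to the LEAD's … (ref. Balaban1985UV3  (7) p.257; no cite tag: route-posited obligation, not a printed fact) -/
def WindowFibreInterior : Prop :=
  ∀ (L : ℕ) (b₀ p₀ : ℝ), 0 < b₀ → 0 < p₀ → ∃ γ₁ : ℝ, 0 < γ₁ ∧ ∀ (F : T3Family) (γ : ℝ), F.L = L → 0 < γ → γ ≤ γ₁ →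
    ∀ (J K : ℕ) (hJK : J ≤ K) (V : GaugeField (F.P J) 0 (Matrix.specialUnitaryGroup (Fin 2) ℂ)), PlaqSmall (θBal F.L γ b₀ p₀ J) V →
      ∃ U : GaugeField (F.P K) 0 (Matrix.specialUnitaryGroup (Fin 2) ℂ),
        descendTo F ℰp J K hJK U = V ∧ U ∈ interior (histGood F ℰp (θBal F.L γ b₀ p₀) K J)

/-! ## §3 GLUE, part 1 (PROVED): a window chart puts `O` inside `regSet` of every `γ′`-weighted restricted density and computes the canonical version -/

section Glue

variable {F : T3Family} {J K : ℕ} {hJK : J ≤ K} {Sfine : Set (GaugeField (F.P K) 0 (Matrix.specialUnitaryGroup (Fin 2) ℂ))}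
  {O : Set (GaugeField (F.P J) 0 (Matrix.specialUnitaryGroup (Fin 2) ℂ))}

/-- The Boltzmann weight is continuous in the configuration. [folklore] -/
theorem continuous_boltzmann (P : Params) (β : ℝ) :
    Continuous (boltzmann P β : GaugeField P 0 (Matrix.specialUnitaryGroup (Fin 2) ℂ) → ℝ) := by
  have hre : Continuous (reTr : Matrix.specialUnitaryGroup (Fin 2) ℂ → ℝ) :=
    UnitaryModel.continuous_nReTr.comp (Literature.MathematicalPhysics.QuantumLattice.continuous_fundamentalRep (Fin 2))
  have hA : Continuous (wilsonAction4 : GaugeField P 0 (Matrix.specialUnitaryGroup (Fin 2) ℂ) → ℝ) := by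
    unfold wilsonAction4 wilsonAction
    exact continuous_finsetSum _ fun p _ =>
      continuous_const.mul (continuous_const.sub (hre.comp (B12ContinuousTransportInvarianceOn.continuous_plaqHol_SU (N := 2) p)))
  unfold boltzmann
  exact Real.continuous_exp.comp (continuous_const.mul hA)

/-- The weighted event density of the glue: measurable, integrable. [cite: Balaban1985UV3, (2) p.256] -/
theorem rho_props (hSm : MeasurableSet Sfine) {β : ℝ} (hβ : 0 ≤ β) :
    Measurable (Sfine.indicator (boltzmann (F.P K) β)) ∧
      Integrable (Sfine.indicator (boltzmann (F.P K) β)) (fieldMeasure (F.P K) 0 (Matrix.specialUnitaryGroup (Fin 2) ℂ)) ∧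
      (∀ x, 0 ≤ Sfine.indicator (boltzmann (F.P K) β) x) ∧ (∀ x, Sfine.indicator (boltzmann (F.P K) β) x ≤ 1) ∧
      (∀ x, Sfine.indicator (boltzmann (F.P K) β) x ≠ 0 → x ∈ Sfine) := by
  refine ⟨(measurable_boltzmann RegularGaugeGroup.measurable_reTr _ _).indicator hSm,
    (integrable_boltzmann RegularGaugeGroup.measurable_reTr _ hβ).indicator hSm,
    fun x => Set.indicator_nonneg (fun y _ => (boltzmann_pos _ _ y).le) x,
    fun x => Set.indicator_apply_le' (fun _ => boltzmann_le_one _ hβ x) (fun _ => zero_le_one),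
    fun x hx => ?_⟩
  by_contra h
  exact hx (by simp [h])

/-- **LEAFWISE DOMINATED CONVERGENCE** for the fibre integral of a window chart. [cite: Balaban1987RG1, (0.13) p.254 (bookkeeping)] -/
theorem continuousOn_fibreInt (c : WindowChart F hJK Sfine O) (_hO : IsOpen O) (hSm : MeasurableSet Sfine) {β : ℝ} (hβ : 0 ≤ β) :
    ContinuousOn (fun V => ∫ z, (c.jac (V, z) : ℝ) * Sfine.indicator (boltzmann (F.P K) β) (c.Φ (V, z))
      ∂fieldMeasure (F.P K) 0 (Matrix.specialUnitaryGroup (Fin 2) ℂ)) O := by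
  obtain ⟨hρm, -, hρ0, hρ1, -⟩ := rho_props (F := F) (K := K) hSm hβ
  set ρ := Sfine.indicator (boltzmann (F.P K) β) with hρ_def
  have hFm : ∀ V, Measurable fun z => (c.jac (V, z) : ℝ) * ρ (c.Φ (V, z)) := fun V =>
    (measurable_coe_nnreal_real.comp (c.measurable_jac.comp measurable_prodMk_left)).mul
      (hρm.comp (c.measurable_Φ.comp measurable_prodMk_left))
  have hFb : ∀ V z, ‖(c.jac (V, z) : ℝ) * ρ (c.Φ (V, z))‖ ≤ (c.bound : ℝ) := fun V z => by
    rw [Real.norm_eq_abs, abs_mul, abs_of_nonneg (c.jac (V, z)).coe_nonneg, abs_of_nonneg (hρ0 _)]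
    calc (c.jac (V, z) : ℝ) * ρ (c.Φ (V, z)) ≤ (c.jac (V, z) : ℝ) * 1 :=
          mul_le_mul_of_nonneg_left (hρ1 _) (c.jac (V, z)).coe_nonneg
      _ ≤ (c.bound : ℝ) := by rw [mul_one]; exact_mod_cast c.jac_le (V, z)
  intro V₀ hV₀
  refine ContinuousAt.continuousWithinAt ?_
  refine continuousAt_of_dominated (bound := fun _ => (c.bound : ℝ)) (Eventually.of_forall fun V => (hFm V).aestronglyMeasurable)
    (Eventually.of_forall fun V => Eventually.of_forall fun z => hFb V z) (integrable_const _) ?_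
  filter_upwards [c.regular V₀ hV₀] with z hz
  rcases hz with ⟨hj, hΦ, hfr⟩ | hev
  · by_cases h0 : c.jac (V₀, z) = 0
    · -- the Jacobian vanishes at the leaf point: squeeze
      have hlim : Tendsto (fun V => (c.jac (V, z) : ℝ)) (𝓝 V₀) (𝓝 0) := by
        have := hj.tendsto
        rwa [h0, NNReal.coe_zero] at this
      have hF0 : (c.jac (V₀, z) : ℝ) * ρ (c.Φ (V₀, z)) = 0 := by rw [h0, NNReal.coe_zero, zero_mul]
      show Tendsto (fun V => (c.jac (V, z) : ℝ) * ρ (c.Φ (V, z))) (𝓝 V₀) (𝓝 ((c.jac (V₀, z) : ℝ) * ρ (c.Φ (V₀, z))))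
      rw [hF0]
      refine squeeze_zero_norm' (Eventually.of_forall fun V => ?_) hlim
      rw [Real.norm_eq_abs, abs_mul, abs_of_nonneg (c.jac (V, z)).coe_nonneg, abs_of_nonneg (hρ0 _)]
      calc (c.jac (V, z) : ℝ) * ρ (c.Φ (V, z)) ≤ (c.jac (V, z) : ℝ) * 1 :=
            mul_le_mul_of_nonneg_left (hρ1 _) (c.jac (V, z)).coe_nonneg
        _ = (c.jac (V, z) : ℝ) := mul_one _
    · -- off the frontier: the indicator is continuous at the leaf point
      have hρat : ContinuousAt ρ (c.Φ (V₀, z)) :=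
        ContinuousOn.continuousAt_indicator (continuous_boltzmann (F.P K) β).continuousOn (hfr h0)
      exact hj.mul (ContinuousAt.comp (g := ρ) (f := fun V => c.Φ (V, z)) hρat hΦ)
  · -- the leaf is eventually off the event near `V₀`: the integrand vanishes identically there
    have hzero : (fun _ : GaugeField (F.P J) 0 (Matrix.specialUnitaryGroup (Fin 2) ℂ) => (0 : ℝ)) =ᶠ[𝓝 V₀]
        fun V => (c.jac (V, z) : ℝ) * ρ (c.Φ (V, z)) := by
      filter_upwards [hev] with V hV
      rcases hV with hV | hV
      · rw [hV, NNReal.coe_zero, zero_mul]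
      · rw [hρ_def, Set.indicator_of_notMem hV, mul_zero]
    exact continuousAt_const.congr hzero

/-- **(R) FROM A CHART (PROVED)**: a window chart on `Sfine` over the open `O` puts `O` inside `regSet`. [cite: Balaban1987RG1, (2.10) p.267 and (0.13) p.254] -/
theorem chart_subset_regSet (c : WindowChart F hJK Sfine O) (hO : IsOpen O) (hSm : MeasurableSet Sfine) {γ' : ℝ} (hγ' : 0 ≤ γ') :
    O ⊆ Node00.regSet (fieldMeasure (F.P J) 0 (Matrix.specialUnitaryGroup (Fin 2) ℂ)) (heightDensity F γ' hJK Sfine) := by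
  have hβ : 0 ≤ (F.scheme ℰp γ').β K := F.scheme_β_nonneg ℰp hγ' K
  obtain ⟨-, hρi, -, -, hρS⟩ := rho_props (F := F) (K := K) hSm hβ
  exact Node00.subset_regSet_transform_of_fibredChart_of_ne_zero hO (measurable_descendTo F ℰp measurableE_ℰp hJK) c.measurable_Φ c.measurable_jac
    c.descendTo_Φ c.map_Φ hρi hρS (heightDensity_props F hJK hSm hγ').2.integrableOn
    (fun f hf hC => Summit.QuantumFields.YangMills.Theorems.LogComparisonOneTower.integral_heightDensity_mul F K hJK hγ' hSm f hf hC)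
    (continuousOn_fibreInt c hO hSm hβ)

/-- **THE CANONICAL VERSION IS THE FIBRE INTEGRAL ON `O` (PROVED)** … [cite: Balaban1987RG1, (0.13) p.254] -/
theorem heightDensityCan_eq_fibreInt (c : WindowChart F hJK Sfine O) (hO : IsOpen O) (hSm : MeasurableSet Sfine) {γ' : ℝ} (hγ' : 0 ≤ γ')
    {V : GaugeField (F.P J) 0 (Matrix.specialUnitaryGroup (Fin 2) ℂ)} (hV : V ∈ O) :
    heightDensityCan F γ' hJK Sfine V = ∫ z, (c.jac (V, z) : ℝ) *
      Sfine.indicator (boltzmann (F.P K) ((F.scheme ℰp γ').β K)) (c.Φ (V, z)) ∂fieldMeasure (F.P K) 0 (Matrix.specialUnitaryGroup (Fin 2) ℂ) := by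
  haveI := B12ContinuousTransportInvariance.isOpenPosMeasure_fieldMeasure_SU (N := 2) (F.P J) 0
  have hβ : 0 ≤ (F.scheme ℰp γ').β K := F.scheme_β_nonneg ℰp hγ' K
  obtain ⟨-, hρi, -, -, hρS⟩ := rho_props (F := F) (K := K) hSm hβ
  have havg := measurable_descendTo F ℰp measurableE_ℰp hJK
  refine Node00.canonVersion_eqOn_of_forall_integral_mul_eq hO (heightDensity_props F hJK hSm hγ').2.integrableOn
    (Node00.integrableOn_fibreIntegral_of_fibredChart c.measurable_Φ c.measurable_jac c.map_Φ hρi).locallyIntegrableOn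
    (continuousOn_fibreInt c hO hSm hβ) (fun f hf hC hf0 => ?_) hV
  exact (Summit.QuantumFields.YangMills.Theorems.LogComparisonOneTower.integral_heightDensity_mul F K hJK hγ' hSm f hf hC).trans
    (Node00.integral_mul_comp_eq_integral_fibreIntegral_mul_of_ne_zero hO.measurableSet havg c.measurable_Φ c.measurable_jac c.descendTo_Φ c.map_Φ
      hρi hρS hf hC hf0)

/-- **(P) FROM A CHART (PROVED)**. [cite: Balaban1985UV3, (2) p.256 and (41) p.266] -/
theorem chart_pos (c : WindowChart F hJK Sfine O) (hO : IsOpen O) (hSm : MeasurableSet Sfine) {γ' : ℝ} (hγ' : 0 ≤ γ')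
    {V : GaugeField (F.P J) 0 (Matrix.specialUnitaryGroup (Fin 2) ℂ)} (hV : V ∈ O)
    (hint : ∃ U, descendTo F ℰp J K hJK U = V ∧ U ∈ interior Sfine) :
    0 < heightDensityCan F γ' hJK Sfine V := by
  have hβ : 0 ≤ (F.scheme ℰp γ').β K := F.scheme_β_nonneg ℰp hγ' K
  obtain ⟨hρm, -, hρ0, hρ1, -⟩ := rho_props (F := F) (K := K) hSm hβ
  set ρ := Sfine.indicator (boltzmann (F.P K) ((F.scheme ℰp γ').β K)) with hρ_def
  rw [heightDensityCan_eq_fibreInt c hO hSm hγ' hV]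
  have hFm : Measurable fun z => (c.jac (V, z) : ℝ) * ρ (c.Φ (V, z)) :=
    (measurable_coe_nnreal_real.comp (c.measurable_jac.comp measurable_prodMk_left)).mul
      (hρm.comp (c.measurable_Φ.comp measurable_prodMk_left))
  have hFi : Integrable (fun z => (c.jac (V, z) : ℝ) * ρ (c.Φ (V, z))) (fieldMeasure (F.P K) 0 (Matrix.specialUnitaryGroup (Fin 2) ℂ)) := by
    refine (integrable_const (c.bound : ℝ)).mono' hFm.aestronglyMeasurable (Eventually.of_forall fun z => ?_)
    rw [Real.norm_eq_abs, abs_mul, abs_of_nonneg (c.jac (V, z)).coe_nonneg, abs_of_nonneg (hρ0 _)]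
    calc (c.jac (V, z) : ℝ) * ρ (c.Φ (V, z)) ≤ (c.jac (V, z) : ℝ) * 1 :=
          mul_le_mul_of_nonneg_left (hρ1 _) (c.jac (V, z)).coe_nonneg
      _ ≤ (c.bound : ℝ) := by rw [mul_one]; exact_mod_cast c.jac_le (V, z)
  rw [integral_pos_iff_support_of_nonneg_ae (Eventually.of_forall fun z => mul_nonneg (c.jac (V, z)).coe_nonneg (hρ0 _)) hFi]
  refine lt_of_lt_of_le (c.charge V hV hint) (measure_mono fun z hz => ?_)
  obtain ⟨hj, hS⟩ := hz
  rw [Function.mem_support]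
  refine mul_ne_zero (by exact_mod_cast hj) ?_
  rw [hρ_def, Set.indicator_of_mem hS]
  exact (boltzmann_pos _ _ _).ne'

end Glue

/-! ## §4 GLUE, part 2 (PROVED): CHART ∧ INTERIOR ⇒ WREG -/

/-- **WREG FROM THE TABLE (PROVED).** [cite: Balaban1987RG1, (2.10) p.267; Balaban1985UV3, (2) p.256] -/
theorem windowRegularity_of_chart (hC : WindowChartsExist) (hI : WindowFibreInterior) : WindowRegularity := by
  intro L b₀ p₀ hb hp
  obtain ⟨γC, hγC, hCF⟩ := hC L b₀ p₀ hb hp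
  obtain ⟨γI, hγI, hIF⟩ := hI L b₀ p₀ hb hp
  refine ⟨min γC γI, lt_min hγC hγI, fun F γ hL hγ hγle J K hJK γ' hγ' => ?_⟩
  have hSm : MeasurableSet (histGood F ℰp (θBal F.L γ b₀ p₀) K J) := measurableSet_histGood F ℰp measurableE_ℰp _ K J
  refine ⟨fun V₀ hV₀ => ?_, fun V₀ hV₀ => ?_⟩
  · obtain ⟨O, hO, hVO, ⟨c⟩⟩ := hCF F γ hL hγ (hγle.trans (min_le_left _ _)) J K hJK V₀ hV₀
    exact chart_subset_regSet c hO hSm hγ'.le hVO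
  · obtain ⟨O, hO, hVO, ⟨c⟩⟩ := hCF F γ hL hγ (hγle.trans (min_le_left _ _)) J K hJK V₀ hV₀
    exact chart_pos c hO hSm hγ'.le hVO (hIF F γ hL hγ (hγle.trans (min_le_right _ _)) J K hJK V₀ hV₀)


end Summit.QuantumFields.YangMills.Theorems.FluctuationComparisonRegPrIntLWregGlue

end
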